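import Summits.ValiantsHypothesis.ValiantsHypothesis.Theorems.TwistedDetRankFermionicNormalFormDefs
import Summits.ValiantsHypothesis.ValiantsHypothesis.Theorems.TwistedDetRankFermionicNormalFormConeGlue
import Summits.ValiantsHypothesis.ValiantsHypothesis.Theorems.TwistedDetRankFermionicNormalFormStubSmallSupportRepr
import Summits.ValiantsHypothesis.ValiantsHypothesis.Theorems.TwistedDetRankFermionicNormalFormStubCardCyclesLE
import Summits.ValiantsHypothesis.ValiantsHypothesis.Theorems.TwistedDetRankFermionicNormalFormStubCardSmallSupport

/-!
# Crux `TwistedDetRank.FermionicNormalForm` (stmt-ValiantsHypothesis-6283), line `registered` —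
# the construction half: local generators have few twisted determinants (stub B, unconditional)

`stub_localGeneratorsSmallTdr` (= `LocalGeneratorsSmallTdr` of
`TwistedDetRankFermionicNormalFormDefs`, verbatim): every local generator of weight `w` on `S_n`,
`n ≥ 1`, is a sum of `(n+1)^(w+1)` Hadamard-twisted determinants `det(X ∘ E_t)`.  Assembled from the
landed function-level stubs of the line (B1a `stub_smallSupportRepr`, B1b `stub_cardSmallSupport`,
B2a `stub_cycleCountEqCard`, B2b `stub_partialMapTwist`, B2c `stub_cardCyclesLE`) and the cone glue
(`TwistedDetRankFermionicNormalFormConeGlue`):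

* `fermionic_node_repr` (B2d) — at a fixed node `u`, `σ ↦ sgn σ · u^{c₁ σ} · Π_{j∈m} c_j(σ)` is a cone
  sum of length `≤ (n+1)^w`: expand the product of cycle counts over TUPLES of cycles
  (`Finset.prod_univ_sum`), one twist per tuple (`tuple_twist`), `≤ n^{m.sum}` tuples
  (`stub_cardCyclesLE`);
* the fermionic end by interpolation in `c₁` over `u = 0, …, n` (`stub_fixedPointInterpolation`,
  `cone_lincomb`), the perturbative end by `stub_smallSupportRepr` + `stub_cardSmallSupport`,
  zero padding (`cone_pad`), and the bridge `gmf_eq_of_repr`.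

With this file the line `registered` is the crux CLOSED MODULO its bet A
(`CheapClassFunctionsAreQuasiLocal`, which implies the summit:
`valiantsHypothesis_of_cheapClassFunctionsAreQuasiLocal`).  Sources: Marcus–Minc 1961; Bürgisser
2000, §7.1.  Elementary; no named facts, no definitions.
-/

-- single-conjunct layout: Sub = Summit, duplicated namespace component intended
set_option linter.dupNamespace false

noncomputable section

namespace Summit.ValiantsHypothesis.ValiantsHypothesis.Theorems.TwistedDetRankFermionicNormalForm

open Equiv
open scoped BigOperators

/-- B2d — the fermionic end at a fixed interpolation node `u`: for a multiset `m` of cycle lengths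
`≥ 2` with `m.sum ≤ w`, the class function `σ ↦ sgn σ · u^{c₁ σ} · Π_{j ∈ m} c_j(σ)` is a cone sum of
length `≤ (n+1)^w` (expand the product over tuples of cycles, one twist per tuple by `tuple_twist`,
and count tuples with the landed `stub_cardCyclesLE`). [MarcusMinc1961; Burgisser2000 §7.1] -/
theorem fermionic_node_repr (n w : ℕ) (u : ℂ)
    (m : Multiset ℕ) (hn : 1 ≤ n) (hmw : m.sum ≤ w) :
    ∃ r ≤ (n + 1) ^ w, ∃ E : Fin r → Matrix (Fin n) (Fin n) ℂ, ∀ σ : Perm (Fin n),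
      ((Perm.sign σ : ℤ) : ℂ) * u ^ (Finset.univ.filter fun i => σ i = i).card *
          (m.map fun j => ((σ.cycleType.count j : ℕ) : ℂ)).prod =
        ∑ t, ((Perm.sign σ : ℤ) : ℂ) * ∏ i, E t (σ i) i := by
  classical
  -- tuples of cycles indexed by the elements of `m`
  let T := ∀ x : m, {γ : Perm (Fin n) // γ.cycleType = {(x : ℕ)}}
  -- one twist per tuple
  have htw : ∀ τ : T, ∃ E : Matrix (Fin n) (Fin n) ℂ, ∀ σ : Perm (Fin n),
      u ^ (Finset.univ.filter fun i => σ i = i).card *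
          ∏ x, (if ∀ i ∈ (τ x).1.support, σ i = (τ x).1 i then (1 : ℂ) else 0) =
        ∏ i, E (σ i) i := fun τ =>
    tuple_twist hn u (fun x => (τ x).1) fun x => ((cycleType_eq_singleton_iff _).1 (τ x).2).1
  choose E hE using htw
  -- the count
  have hcard : Fintype.card T ≤ (n + 1) ^ w := by
    show Fintype.card (∀ x : m, {γ : Perm (Fin n) // γ.cycleType = {(x : ℕ)}}) ≤ (n + 1) ^ w
    rw [Fintype.card_pi]
    calc ∏ x : m, Fintype.card {γ : Perm (Fin n) // γ.cycleType = {(x : ℕ)}}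
        ≤ ∏ x : m, n ^ (x : ℕ) := by
          refine Finset.prod_le_prod (fun x _ => Nat.zero_le _) fun x _ => ?_
          rw [Fintype.card_subtype]
          exact stub_cardCyclesLE n x
      _ = n ^ (∑ x : m, (x : ℕ)) := Finset.prod_pow_eq_pow_sum _ _ _
      _ = n ^ m.sum := by rw [← Multiset.sum_eq_sum_coe]
      _ ≤ n ^ w := Nat.pow_le_pow_right hn hmw
      _ ≤ (n + 1) ^ w := Nat.pow_le_pow_left (Nat.le_succ n) w
  refine ⟨Fintype.card T, hcard, fun t => E ((Fintype.equivFin T).symm t), fun σ => ?_⟩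
  -- expand the product of cycle counts over tuples
  have hprod : (m.map fun j => ((σ.cycleType.count j : ℕ) : ℂ)).prod =
      ∑ τ : T, ∏ x, (if ∀ i ∈ (τ x).1.support, σ i = (τ x).1 i then (1 : ℂ) else 0) := by
    have h1 : (m.map fun j => ((σ.cycleType.count j : ℕ) : ℂ)).prod =
        ∏ x : m, ((σ.cycleType.count (x : ℕ) : ℕ) : ℂ) := by
      rw [Finset.prod_eq_multiset_prod]
      exact (congrArg Multiset.prod
        (Multiset.map_univ m fun j => ((σ.cycleType.count j : ℕ) : ℂ))).symm
    rw [h1]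
    simp_rw [count_eq_sum_ind]
    rw [Finset.prod_univ_sum (fun _ => Finset.univ), Fintype.piFinset_univ]
  rw [mul_assoc, hprod, Finset.mul_sum, Finset.mul_sum]
  rw [← Equiv.sum_comp (Fintype.equivFin T).symm]
  refine Finset.sum_congr rfl fun t _ => ?_
  rw [← hE]

/-- **Stub B** (`stub_localGeneratorsSmallTdr`, registered; = `LocalGeneratorsSmallTdr` verbatim):
a local generator of weight `w` on `S_n`, `n ≥ 1`, is a sum of `(n+1)^(w+1)` twisted determinants —
the fermionic end by interpolation in `c₁` (`stub_fixedPointInterpolation`) over the nodes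
`u = 0, …, n` of `fermionic_node_repr` (`(n+1)·(n+1)^w = (n+1)^(w+1)` twists), the perturbative end
by the landed `stub_smallSupportRepr` and the count `stub_cardSmallSupport`, padding with zero
twists; the bridge to polynomials is `gmf_eq_of_repr`. [MarcusMinc1961; Burgisser2000 §7.1] -/
theorem stub_localGeneratorsSmallTdr :
    ∀ (n w : ℕ) (g : Equiv.Perm (Fin n) → ℂ), 1 ≤ n → IsLocalGenerator n w g →
      ∃ E : Fin ((n + 1) ^ (w + 1)) → Matrix (Fin n) (Fin n) ℂ,
        (∑ σ : Equiv.Perm (Fin n), MvPolynomial.C (g σ) *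
            ∏ i : Fin n, (MvPolynomial.X (σ i, i) : MvPolynomial (Fin n × Fin n) ℂ)) =
          ∑ t, (Matrix.of fun i j => MvPolynomial.C (E t i j) * MvPolynomial.X (i, j)).det := by
  intro n w g hn hg
  suffices hrepr : ∃ E : Fin ((n + 1) ^ (w + 1)) → Matrix (Fin n) (Fin n) ℂ, ∀ σ : Perm (Fin n),
      g σ = ∑ t, ((Perm.sign σ : ℤ) : ℂ) * ∏ i, E t (σ i) i by
    obtain ⟨E, hE⟩ := hrepr
    exact ⟨E, gmf_eq_of_repr g E hE⟩
  rcases hg with ⟨F, m, -, hmw, rfl⟩ | ⟨G, rfl⟩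
  · -- fermionic end
    obtain ⟨β, hβ⟩ := stub_fixedPointInterpolation n F
    have hu : ∀ u : Fin (n + 1), ∃ E : Fin ((n + 1) ^ w) → Matrix (Fin n) (Fin n) ℂ,
        ∀ σ : Perm (Fin n),
          ((Perm.sign σ : ℤ) : ℂ) * ((u : ℕ) : ℂ) ^ (Finset.univ.filter fun i => σ i = i).card *
              (m.map fun j => ((σ.cycleType.count j : ℕ) : ℂ)).prod =
            ∑ t, ((Perm.sign σ : ℤ) : ℂ) * ∏ i, E t (σ i) i := fun u => by
      obtain ⟨r, hr, E, hE⟩ := fermionic_node_repr n w ((u : ℕ) : ℂ) m hn hmw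
      obtain ⟨E', hE'⟩ := cone_pad hn hr E
      exact ⟨E', fun σ => (hE σ).trans (hE' σ)⟩
    choose E hE using hu
    obtain ⟨E', hE'⟩ := cone_lincomb hn β _ E hE
    obtain ⟨E'', hE''⟩ :=
      cone_pad (N := (n + 1) ^ (w + 1)) hn (le_of_eq (by ring)) E'
    refine ⟨E'', fun σ => ?_⟩
    rw [← hE'' σ, ← hE' σ]
    dsimp only
    rw [hβ _ (card_fix_le σ), Finset.mul_sum, Finset.sum_mul]
    exact Finset.sum_congr rfl fun u _ => by ring
  · -- perturbative end
    obtain ⟨r, E, hr, hE⟩ := stub_smallSupportRepr n w G hn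
    have hrle : r ≤ (n + 1) ^ (w + 1) :=
      hr ▸ (stub_cardSmallSupport n w).trans (Nat.pow_le_pow_right (Nat.succ_pos n) (Nat.le_succ w))
    obtain ⟨E', hE'⟩ := cone_pad hn hrle E
    exact ⟨E', fun σ => (hE σ).trans (hE' σ)⟩


end Summit.ValiantsHypothesis.ValiantsHypothesis.Theorems.TwistedDetRankFermionicNormalForm

end
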